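import Summits.HodgeConjecture.HodgeConjecture.Theorems.TropicalWeilObstructionTropicalHodgeBoundCheckerSound
import Summits.HodgeConjecture.HodgeConjecture.Theorems.TropicalWeilObstructionTropicalHodgeBoundCheckerBridge

/-!
# Crux `TropicalHodgeBound` (stmt-HodgeConjecture-18480), stub 4 — part C2c: the checker's equations are
# the coefficient equations

Route `TropicalWeilObstruction` of `HodgeConjecture`, registered line `birth`
(`Cruxes/TropicalHodgeBound/Lines/birth.lean`), stub `stub_rationalHodgeCoordinates`; ingredient (C).

For an alternating integer table `y` on pairs of words `Fin 4 → Fin 8` satisfying the coefficient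
equations of `…Genericity` (`coeffEquation_eq_zero`: one integer linear equation per monomial of the
eigenwave identity), every equation the checker decodes from a packed step (`Chk.stepEq n`, ANY `n`)
evaluates to `0` under the checker's valuation `yvOf y` (`stepEq_eval_eq_zero`). The proof unfolds the
row-candidate enumeration of `eqTermsM` into a sum over all words (the candidate conditions are implied
by the key condition), identifies key equality with monomial equality (`keyN_eq_iff`), the sign product
with `signProd`, and transports `y` to increasing representatives (`y_eq_transport`). No named fact,
no sorry.

References: [Zharkov2020TropicalWeil] I. Zharkov, arXiv:2002.02347, §2; [MikhalkinZharkov2014Eigenwave]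
G. Mikhalkin, I. Zharkov, LN UMI 15 (2014), Thm. 5.4.
-/

set_option linter.dupNamespace false

namespace Summit.HodgeConjecture.HodgeConjecture.Theorems.TropicalHodgeBound

open Literature.AlgebraicGeometry.Tropical

namespace Chk

/-! ### List sums -/

section ListSums

variable (yv : ℕ → ℤ)

/-- `evalL` of a `flatMap`. [folklore] -/
theorem evalL_flatMap {α : Type*} (g : α → List (ℕ × ℤ)) :
    ∀ l : List α, evalL yv (l.flatMap g) = (l.map fun x => evalL yv (g x)).sum
  | [] => by simp
  | x :: l => by rw [List.flatMap_cons, evalL_append, evalL_flatMap g l]; simp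

/-- `evalL` of a guarded `filterMap`. [folklore] -/
theorem evalL_filterMap_ite {α : Type*} (P : α → Prop) [DecidablePred P] (T : α → ℕ × ℤ) :
    ∀ l : List α, evalL yv (l.filterMap fun x => if P x then some (T x) else none) =
      (l.map fun x => if P x then (T x).2 * yv (T x).1 else 0).sum
  | [] => by simp
  | x :: l => by
      rw [List.filterMap_cons]
      by_cases h : P x
      · simp only [h, if_true, List.map_cons, List.sum_cons, evalL_cons]
        rw [evalL_filterMap_ite P T l]
      · simp only [h, if_false, List.map_cons, List.sum_cons, zero_add]
        exact evalL_filterMap_ite P T l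

end ListSums

/-- Summing over a filtered list is summing guarded terms. [folklore] -/
theorem sum_map_filter {α : Type*} (Q : α → Bool) (F : α → ℤ) :
    ∀ l : List α, ((l.filter Q).map F).sum = (l.map fun x => if Q x = true then F x else 0).sum
  | [] => by simp
  | x :: l => by
      rw [List.filter_cons]
      by_cases h : Q x = true
      · simp only [h, if_true, List.map_cons, List.sum_cons, sum_map_filter Q F l]
      · simp only [h, if_false, List.map_cons, List.sum_cons, zero_add, sum_map_filter Q F l,
          Bool.false_eq_true]

/-- A sum over `List.range n` is a sum over `Fin n`. [folklore] -/
theorem sum_map_range (F : ℕ → ℤ) : ∀ n : ℕ, ((List.range n).map F).sum = ∑ x : Fin n, F x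
  | 0 => by simp
  | n + 1 => by
      rw [List.range_succ, List.map_append, List.sum_append, sum_map_range F n, Fin.sum_univ_castSucc]
      simp

/-- Words as quadruples: a fourfold sum over letters is a sum over words. [folklore] -/
theorem sum_fin4_fun (G : (Fin 4 → Fin (2 * 4)) → ℤ) :
    ∑ a : Fin (2 * 4), ∑ b : Fin (2 * 4), ∑ e : Fin (2 * 4), ∑ f : Fin (2 * 4), G ![a, b, e, f] =
      ∑ c : Fin 4 → Fin (2 * 4), G c := by
  let eqv : (Fin (2 * 4) × Fin (2 * 4) × Fin (2 * 4) × Fin (2 * 4)) ≃ (Fin 4 → Fin (2 * 4)) :=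
    { toFun := fun p => ![p.1, p.2.1, p.2.2.1, p.2.2.2]
      invFun := fun c => (c 0, c 1, c 2, c 3)
      left_inv := fun p => rfl
      right_inv := fun c => (word_eta c).symm }
  rw [← Fintype.sum_equiv eqv (fun p => G ![p.1, p.2.1, p.2.2.1, p.2.2.2]) G (fun p => rfl)]
  rw [Fintype.sum_prod_type]
  refine Finset.sum_congr rfl fun a _ => ?_
  rw [Fintype.sum_prod_type]
  refine Finset.sum_congr rfl fun b _ => ?_
  rw [Fintype.sum_prod_type]

/-- Dropping guards implied by the summand's own condition (four nested levels). [folklore] -/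
theorem sum4_guard (Q0 Q1 Q2 Q3 : Fin (2 * 4) → Prop) [DecidablePred Q0] [DecidablePred Q1]
    [DecidablePred Q2] [DecidablePred Q3]
    (P : Fin (2 * 4) → Fin (2 * 4) → Fin (2 * 4) → Fin (2 * 4) → Prop) [∀ a b e f, Decidable (P a b e f)]
    (v : Fin (2 * 4) → Fin (2 * 4) → Fin (2 * 4) → Fin (2 * 4) → ℤ)
    (h : ∀ a b e f, P a b e f → Q0 a ∧ Q1 b ∧ Q2 e ∧ Q3 f) :
    (∑ a, if Q0 a then ∑ b, if Q1 b then ∑ e, if Q2 e then ∑ f, (if Q3 f then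
        (if P a b e f then v a b e f else 0) else 0) else 0 else 0 else 0) =
      ∑ a, ∑ b, ∑ e, ∑ f, if P a b e f then v a b e f else 0 := by
  refine Finset.sum_congr rfl fun a _ => ?_
  by_cases h0 : Q0 a
  · rw [if_pos h0]
    refine Finset.sum_congr rfl fun b _ => ?_
    by_cases h1 : Q1 b
    · rw [if_pos h1]
      refine Finset.sum_congr rfl fun e _ => ?_
      by_cases h2 : Q2 e
      · rw [if_pos h2]
        refine Finset.sum_congr rfl fun f _ => ?_
        by_cases h3 : Q3 f
        · rw [if_pos h3]
        · rw [if_neg h3, if_neg (fun hP => h3 (h a b e f hP).2.2.2)]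
      · rw [if_neg h2]; symm
        exact Finset.sum_eq_zero fun f _ => if_neg fun hP => h2 (h a b e f hP).2.2.1
    · rw [if_neg h1]; symm
      exact Finset.sum_eq_zero fun e _ => Finset.sum_eq_zero fun f _ =>
        if_neg fun hP => h1 (h a b e f hP).2.1
  · rw [if_neg h0]; symm
    exact Finset.sum_eq_zero fun b _ => Finset.sum_eq_zero fun e _ => Finset.sum_eq_zero fun f _ =>
      if_neg fun hP => h0 (h a b e f hP).1

/-! ### Alternating tables vanish on non-injective words -/

/-- An alternating table vanishes when two letters coincide. [folklore] -/
theorem y_eq_zero_of_eq (y : (Fin 4 → Fin (2 * 4)) → (Fin 4 → Fin (2 * 4)) → ℤ)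
    (hyI : ∀ (c d : Fin 4 → Fin (2 * 4)) (τ : Equiv.Perm (Fin 4)),
      y (c ∘ τ) d = ((Equiv.Perm.sign τ : ℤˣ) : ℤ) * y c d)
    (c d : Fin 4 → Fin (2 * 4)) (i j : Fin 4) (hij : i ≠ j) (h : c i = c j) : y c d = 0 := by
  have h1 := hyI c d (Equiv.swap i j)
  have h2 : c ∘ Equiv.swap i j = c := by
    funext k
    simp only [Function.comp_apply]
    rcases eq_or_ne k i with rfl | hki
    · rw [Equiv.swap_apply_left, h]
    · rcases eq_or_ne k j with rfl | hkj
      · rw [Equiv.swap_apply_right, h]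
      · rw [Equiv.swap_apply_of_ne_of_ne hki hkj]
  rw [h2, Equiv.Perm.sign_swap hij] at h1
  simp only [Units.val_neg, Units.val_one, neg_mul, one_mul] at h1
  linarith

/-- `inj4 = false` on the value function produces two equal letters. [folklore] -/
theorem exists_eq_of_inj4 (c : Fin 4 → Fin (2 * 4)) (cn : ℕ → ℕ) (hc : ∀ a : Fin 4, cn a = c a)
    (h : ¬ inj4 cn = true) : ∃ i j : Fin 4, i ≠ j ∧ c i = c j := by
  unfold inj4 at h
  rw [decide_eq_true_eq] at h
  have hc0 : cn 0 = c 0 := hc 0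
  have hc1 : cn 1 = c 1 := hc 1
  have hc2 : cn 2 = c 2 := hc 2
  have hc3 : cn 3 = c 3 := hc 3
  rw [hc0, hc1, hc2, hc3] at h
  simp only [not_and_or, not_not] at h
  rcases h with h | h | h | h | h | h
  · exact ⟨0, 1, by decide, Fin.ext h⟩
  · exact ⟨0, 2, by decide, Fin.ext h⟩
  · exact ⟨0, 3, by decide, Fin.ext h⟩
  · exact ⟨1, 2, by decide, Fin.ext h⟩
  · exact ⟨1, 3, by decide, Fin.ext h⟩
  · exact ⟨2, 3, by decide, Fin.ext h⟩

/-! ### The term-by-term identity -/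

section Terms

variable (y : (Fin 4 → Fin (2 * 4)) → (Fin 4 → Fin (2 * 4)) → ℤ)
  (hyI : ∀ (c d : Fin 4 → Fin (2 * 4)) (τ : Equiv.Perm (Fin 4)),
    y (c ∘ τ) d = ((Equiv.Perm.sign τ : ℤˣ) : ℤ) * y c d)
  (hyJ : ∀ (c d : Fin 4 → Fin (2 * 4)) (τ : Equiv.Perm (Fin 4)),
    y c (d ∘ τ) = ((Equiv.Perm.sign τ : ℤˣ) : ℤ) * y c d)
include hyI hyJ

/-- One term of `eqTermsM`, valued by `yvOf y`, is the corresponding term of the coefficient equation.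
[folklore] -/
theorem term_eq (K c d : Fin 4 → Fin (2 * 4)) (Kn cn dn : ℕ → ℕ) (hK : ∀ a : Fin 4, Kn a = K a)
    (hc : ∀ a : Fin 4, cn a = c a) (hd : ∀ a : Fin 4, dn a = d a) (κ : List ℕ) (s : ℤ) :
    (if keyN Kn cn = κ ∧ spN Kn cn ≠ 0 ∧ inj4 cn = true ∧ inj4 dn = true then
        s * spN Kn cn * sgnN cn * sgnN dn * yvOf y (unkN cn dn) else 0) =
      (if keyN Kn cn = κ then s * signProd K c * y c d else 0) := by
  rw [spN_eq K c Kn cn hK hc]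
  by_cases hk : keyN Kn cn = κ
  · by_cases hs : signProd K c = 0
    · simp [hk, hs]
    · by_cases hci : inj4 cn = true
      · by_cases hdi : inj4 dn = true
        · rw [if_pos ⟨hk, hs, hci, hdi⟩, if_pos hk, y_eq_transport y hyI hyJ c d cn dn hc hd hci hdi]
          ring
        · obtain ⟨i, j, hij, hij'⟩ := exists_eq_of_inj4 d dn hd hdi
          have h0 : y c d = 0 := by
            have := y_eq_zero_of_eq (fun d' c' => y c' d') (fun d' c' τ => hyJ c' d' τ) d c i j hij hij'
            simpa using this
          simp [hk, hdi, h0]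
      · obtain ⟨i, j, hij, hij'⟩ := exists_eq_of_inj4 c cn hc hci
        have h0 : y c d = 0 := y_eq_zero_of_eq y hyI c d i j hij hij'
        simp [hk, hci, h0]
  · simp [hk]

end Terms

/-! ### The decoded objects of a packed step -/

/-- The word `K' : Fin 5 → Fin 8` with octal code `k5`. [folklore] -/
def K5 (k5 : ℕ) : Fin 5 → Fin (2 * 4) := fun i => ⟨kd k5 i, Nat.mod_lt _ (by decide)⟩

/-- The word `J' : Fin 3 → Fin 8` with octal code `j3`. [folklore] -/
def J3 (j3 : ℕ) : Fin 3 → Fin (2 * 4) := fun i => ⟨jd j3 i, Nat.mod_lt _ (by decide)⟩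

/-- The word `Fin 4 → Fin 8` with octal code `n`. [folklore] -/
def W4 (n : ℕ) : Fin 4 → Fin (2 * 4) := fun i => ⟨wd n i, Nat.mod_lt _ (by decide)⟩

/-- **The `m`-th part of the checker's equation is the `m`-th part of the coefficient equation.**
[cite: Zharkov2020TropicalWeil, §2] -/
theorem evalL_eqTermsM (y : (Fin 4 → Fin (2 * 4)) → (Fin 4 → Fin (2 * 4)) → ℤ)
    (hyI : ∀ (c d : Fin 4 → Fin (2 * 4)) (τ : Equiv.Perm (Fin 4)),
      y (c ∘ τ) d = ((Equiv.Perm.sign τ : ℤˣ) : ℤ) * y c d)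
    (hyJ : ∀ (c d : Fin 4 → Fin (2 * 4)) (τ : Equiv.Perm (Fin 4)),
      y c (d ∘ τ) = ((Equiv.Perm.sign τ : ℤˣ) : ℤ) * y c d)
    (k5 j3 : ℕ) (κ : List ℕ) (m : Fin 5) :
    evalL (yvOf y) (eqTermsM k5 j3 κ m) =
      ∑ c : Fin 4 → Fin (2 * 4), if keyN (fun a => kd k5 (sA m a))
          (fn4 (c 0 : ℕ) (c 1 : ℕ) (c 2 : ℕ) (c 3 : ℕ)) = κ then
        (-1 : ℤ) ^ (m : ℕ) * signProd (fun a => K5 k5 (m.succAbove a)) c *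
          y c (Fin.cons (K5 k5 m) (J3 j3)) else 0 := by
  unfold eqTermsM rowCandsN
  simp only [evalL_flatMap, evalL_filterMap_ite, sum_map_filter, sum_map_range, decide_eq_true_eq]
  rw [← sum_fin4_fun]
  have h2 : ∀ a b e f : Fin (2 * 4), (![a, b, e, f] : Fin 4 → Fin (2 * 4)) 2 = e := fun _ _ _ _ => rfl
  have h3 : ∀ a b e f : Fin (2 * 4), (![a, b, e, f] : Fin 4 → Fin (2 * 4)) 3 = f := fun _ _ _ _ => rfl
  simp only [Matrix.cons_val_zero, Matrix.cons_val_one, h2, h3]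
  -- drop the row-candidate guards (they follow from the term's own condition)
  refine (sum4_guard
    (fun a : Fin (2 * 4) => esN (kd k5 (sA m 0)) a ≠ 0 ∧ evN (kd k5 (sA m 0)) a ∈ κ)
    (fun b : Fin (2 * 4) => esN (kd k5 (sA m 1)) b ≠ 0 ∧ evN (kd k5 (sA m 1)) b ∈ κ)
    (fun e : Fin (2 * 4) => esN (kd k5 (sA m 2)) e ≠ 0 ∧ evN (kd k5 (sA m 2)) e ∈ κ)
    (fun f : Fin (2 * 4) => esN (kd k5 (sA m 3)) f ≠ 0 ∧ evN (kd k5 (sA m 3)) f ∈ κ)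
    (fun a b e f => keyN (fun a => kd k5 (sA m a)) (fn4 a b e f) = κ ∧
      spN (fun a => kd k5 (sA m a)) (fn4 a b e f) ≠ 0 ∧ inj4 (fn4 a b e f) = true ∧
      inj4 (fn4 (kd k5 m) (jd j3 0) (jd j3 1) (jd j3 2)) = true)
    (fun a b e f => (-1) ^ (m : ℕ) * spN (fun a => kd k5 (sA m a)) (fn4 a b e f) * sgnN (fn4 a b e f) *
      sgnN (fn4 (kd k5 m) (jd j3 0) (jd j3 1) (jd j3 2)) *
      yvOf y (unkN (fn4 a b e f) (fn4 (kd k5 m) (jd j3 0) (jd j3 1) (jd j3 2)))) ?_).trans ?_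
  · -- the condition implies the guards
    intro a b e f hP
    obtain ⟨hk, hs, -, -⟩ := hP
    have hm : ∀ j : Fin 4, evN (kd k5 (sA m j)) (fn4 a b e f j) ∈ κ := fun j => by
      rw [← hk]; exact evN_mem_keyN (fun a => kd k5 (sA m a)) (fn4 a b e f) j
    have hm0 := hm 0
    have hm1 := hm 1
    have hm2 := hm 2
    have hm3 := hm 3
    simp only [fn4, Fin.val_zero, Fin.val_one, Fin.val_two, show ((3 : Fin 4) : ℕ) = 3 from rfl,
      if_true, show (1 : ℕ) ≠ 0 from by decide, show (2 : ℕ) ≠ 0 from by decide,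
      show (2 : ℕ) ≠ 1 from by decide, show (3 : ℕ) ≠ 0 from by decide, show (3 : ℕ) ≠ 1 from by decide,
      show (3 : ℕ) ≠ 2 from by decide, if_false] at hm0 hm1 hm2 hm3
    unfold spN at hs
    simp only [fn4, if_true, show (1 : ℕ) ≠ 0 from by decide, show (2 : ℕ) ≠ 0 from by decide,
      show (2 : ℕ) ≠ 1 from by decide, show (3 : ℕ) ≠ 0 from by decide, show (3 : ℕ) ≠ 1 from by decide,
      show (3 : ℕ) ≠ 2 from by decide, if_false, mul_ne_zero_iff] at hs
    exact ⟨⟨hs.1.1.1, hm0⟩, ⟨hs.1.1.2, hm1⟩, ⟨hs.1.2, hm2⟩, ⟨hs.2, hm3⟩⟩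
  · -- term by term
    refine Finset.sum_congr rfl fun a _ => Finset.sum_congr rfl fun b _ =>
      Finset.sum_congr rfl fun e _ => Finset.sum_congr rfl fun f _ => ?_
    have hK : ∀ j : Fin 4, (fun a => kd k5 (sA m a)) j =
        (((fun a => K5 k5 (m.succAbove a)) j : Fin (2 * 4)) : ℕ) := by
      intro j; simp only [K5]; rw [sA_eq]
    have hc : ∀ j : Fin 4, fn4 a b e f j = (((![a, b, e, f] : Fin 4 → Fin (2 * 4)) j : Fin (2 * 4)) : ℕ) := by
      intro j; fin_cases j <;> rfl
    have hd : ∀ j : Fin 4, fn4 (kd k5 m) (jd j3 0) (jd j3 1) (jd j3 2) j =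
        (((Fin.cons (K5 k5 m) (J3 j3) : Fin 4 → Fin (2 * 4)) j : Fin (2 * 4)) : ℕ) := by
      intro j; fin_cases j <;> rfl
    exact term_eq y hyI hyJ (fun a => K5 k5 (m.succAbove a)) ![a, b, e, f] (Fin.cons (K5 k5 m) (J3 j3))
      (fun a => kd k5 (sA m a)) (fn4 a b e f) (fn4 (kd k5 m) (jd j3 0) (jd j3 1) (jd j3 2)) hK hc hd κ
      ((-1) ^ (m : ℕ))

/-- **The checker's equations hold**: for every packed step `n`, the decoded equation evaluates to `0`
under `yvOf y`, for every alternating `y` satisfying the coefficient equations of `…Genericity`.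
[cite: Zharkov2020TropicalWeil, §2] -/
theorem stepEq_eval_eq_zero (y : (Fin 4 → Fin (2 * 4)) → (Fin 4 → Fin (2 * 4)) → ℤ)
    (hyI : ∀ (c d : Fin 4 → Fin (2 * 4)) (τ : Equiv.Perm (Fin 4)),
      y (c ∘ τ) d = ((Equiv.Perm.sign τ : ℤˣ) : ℤ) * y c d)
    (hyJ : ∀ (c d : Fin 4 → Fin (2 * 4)) (τ : Equiv.Perm (Fin 4)),
      y c (d ∘ τ) = ((Equiv.Perm.sign τ : ℤˣ) : ℤ) * y c d)
    (heq : ∀ (K' : Fin 5 → Fin (2 * 4)) (J' : Fin 3 → Fin (2 * 4)) (m₀ : Fin 5) (c₀ : Fin 4 → Fin (2 * 4)),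
      ∑ m : Fin 5, ∑ c : Fin 4 → Fin (2 * 4),
        (if (idxList (fun a => K' (m.succAbove a)) c).Perm (idxList (fun a => K' (m₀.succAbove a)) c₀) then
          (-1 : ℤ) ^ (m : ℕ) * signProd (fun a => K' (m.succAbove a)) c * y c (Fin.cons (K' m) J')
        else 0) = 0)
    (n : ℕ) : evalL (yvOf y) (stepEq n) = 0 := by
  unfold stepEq eqTermsN
  -- abbreviations for the decoded codes
  generalize hk5 : n / 4900 / 4096 / 5 / 512 = k5
  generalize hj3 : (n / 4900 / 4096 / 5) % 512 = j3
  generalize hc0 : (n / 4900) % 4096 = c0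
  have hm0lt : (n / 4900 / 4096) % 5 < 5 := Nat.mod_lt _ (by decide)
  generalize hm0 : (n / 4900 / 4096) % 5 = m0 at hm0lt
  -- the five parts
  have hparts : ∀ m : Fin 5, evalL (yvOf y) (eqTermsM k5 j3 (keyN (fun a => kd k5 (sA m0 a)) fun i => wd c0 i) m) =
      ∑ c : Fin 4 → Fin (2 * 4),
        (if (idxList (fun a => K5 k5 (m.succAbove a)) c).Perm
            (idxList (fun a => K5 k5 ((⟨m0, hm0lt⟩ : Fin 5).succAbove a)) (W4 c0)) then
          (-1 : ℤ) ^ (m : ℕ) * signProd (fun a => K5 k5 (m.succAbove a)) c * y c (Fin.cons (K5 k5 m) (J3 j3))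
        else 0) := by
    intro m
    rw [evalL_eqTermsM y hyI hyJ]
    refine Finset.sum_congr rfl fun c _ => if_congr ?_ rfl rfl
    refine keyN_eq_iff (fun a => K5 k5 (m.succAbove a)) c (fun a => K5 k5 ((⟨m0, hm0lt⟩ : Fin 5).succAbove a))
      (W4 c0) _ _ _ _ (fun j => by simp only [K5]; rw [sA_eq]) (fun j => by fin_cases j <;> rfl)
      (fun j => by
        have h := sA_eq ⟨m0, hm0lt⟩ j
        simp only [K5]; rw [h]) (fun j => rfl)
  have e0 := hparts 0
  have e1 := hparts 1
  have e2 := hparts 2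
  have e3 := hparts 3
  have e4 := hparts 4
  simp only [Fin.val_zero, Fin.val_one, Fin.val_two, show ((3 : Fin 5) : ℕ) = 3 from rfl,
    show ((4 : Fin 5) : ℕ) = 4 from rfl] at e0 e1 e2 e3 e4
  rw [evalL_append, evalL_append, evalL_append, evalL_append, e0, e1, e2, e3, e4]
  have htot := heq (K5 k5) (J3 j3) ⟨m0, hm0lt⟩ (W4 c0)
  rw [Fin.sum_univ_five] at htot
  simpa using htot

end Chk

end Summit.HodgeConjecture.HodgeConjecture.Theorems.TropicalHodgeBound
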